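import Summits.QuantumFields.YangMills.Theorems.UnitScaleTiltProp7LODCubeGaugeFamily
import Summits.QuantumFields.YangMills.Theorems.UnitScaleTiltProp7LocalComparisonKnit
import HarnessLib

/-!
# Route `UnitScaleTilt`, crux «MinimiserStabilityRegPr» (stmt-QuantumFields-19200, stub EX), γ-row `hGF[Lift]` (LOD line, Step I.2) — ★★★ THE PER-CUBE (L6) COMPARISON WITH THE
# GAUGE ROWS DISCHARGED: ✓`Prop7LocalComparisonKnit.localComparison_of_cube` at the cube gauge `σ_c := axialT U₀ c` of ✓`Prop7LODCubeGaugeFamily`, its three flatness∕`Q_k` binders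
# `hVplaq`, `hVbond`, `hKrow` fed by ✓`hVplaq_cubeGauge` ∕ ✓`hVbond_cubeGauge` ∕ ✓`normSq_Qk_one_conj_le_cubeGauge` — only `hloc` ((L5″) member rows) and `hP1abs` (★p1 ✓p750717) stay displayed

Cell `ym3-torus` (rung R3 — YM₃ on T³; NOT d = 4, NOT the Clay problem).  Width seat `ym-routeR-w4` g26.  THEOREMS ONLY (0 `def`, 0 `sorry`); `--supports stmt-QuantumFields-19200 --as helper`;
count-neutral.

THE POINT.  routeR-w3 g12's ✓p754654 `localComparison_of_cube` is w5's `hcmp` at one cube piece `X` for an ARBITRARY gauge `σ` with five displayed rows.  With the centre-based axial gauge of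
✓p756563 three of them are theorems of `RegPr` alone, for every field `X` supported within torus distance `R₀` of the centre `c` (`X b ≠ 0 → tdist(c, b₋) ≤ R₀`; px17's cut-off
`χ_c`: `R₀ = 3L^sℓ` by ✓`tdist_le_of_hsupp`) under the no-wrap `2(R₀ + 8ℓ + 1) ≤ sitesPerDir 0` (⟸ `s + 2 ≤ m + n`): this file states `localComparison_of_cube` with `σ := axialT U₀ c`,
`δ := δ_c = 2·regThreshold·(R₀ + 7ℓ)` and `cK := (1+θ⁻¹)·4·(3·10¹⁰L¹⁰ε₀² + 192(ℓδ_c)²)·cB∕(c₀ℓ^d)` SUBSTITUTED and the binders `hVplaq`∕`hVbond`∕`hKrow` REMOVED — verbatim otherwise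
(`Q₀ hseq₀ Q₁ hseq₁ Qf hloc hP1abs` unchanged), so the hcmp ∀-form is `fun c A => localComparison_of_cube_cubeGauge … c (χ_c•A) (tdist_le_of_hsupp …) hwrap … hloc_c hP1abs_c`.
HONEST SCOPE.  A substitution instance; `hloc` ((RB1)(RB2)(RN) member rows through routeR-w3's 2h∕2n∕2r doors) and `hP1abs` remain hypotheses; the ∀-fold, `hT`, `hGF`, the print rows,
`hThm2S`, EX and the crux are NOT proved here.
References: T. Bałaban, CMP **99** (1985) 389–434 [Balaban1985BackgroundPropagators] ((3.13)–(3.16) p.393, (3.100) pp.413–414, Thm 3.11 p.416); CMP **99** (1985) 75–102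
[Balaban1985RegularSpaces] (Lemma 1 (1.25) p.79); CMP **98** (1985) 17–51 [Balaban1985Averaging] (pp.24–25).
-/

set_option autoImplicit false

noncomputable section

open scoped BigOperators Matrix.Norms.L2Operator InnerProductSpace ComplexConjugate

namespace Summit.QuantumFields.YangMills.Theorems.Prop7LocalComparisonCubeGauge

open Literature.MathematicalPhysics.QuantumFieldTheory.Balaban1983to89
open Literature.MathematicalPhysics.QuantumFieldTheory.Balaban1983to89.T3ContinuumYM3Torus
open Literature.MathematicalPhysics.QuantumFieldTheory.Balaban1983to89.T3PrintedRegularMinimiser (RegPr)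
open T4Continuum BlockAveraging
open BlockAveraging (Idx)
open B7Prop1Explicit (disp)
open B10Eq27TorusAxialLog (holT transl axialT)
open B7TransferAnalyticMean (meanCLM)
open B15DeterminingSets (embIter)
open B11Eq103H1Complex (SiteL2K BondL2K projR)
open Summit.QuantumFields.YangMills.Theorems.Prop8Chart (emlIterU)
open T3SectALandauChart (eta eta_pos bgUnits)
open T3RegularMinimiser (regThreshold regThreshold_pos)
open Summit.QuantumFields.YangMills.Theorems.Prop7SectET3Transport (periodsT3)
open Summit.QuantumFields.YangMills.Theorems.Prop7SectET3HilbertLetters (W₂ toL2 toL2S DstarL2 covLapSite)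
open Summit.QuantumFields.YangMills.Theorems.Prop7SectET3WilsonHessian (DeltaEta)
open Summit.QuantumFields.YangMills.Theorems.Prop7SectET3CurvedPropagators (Qk)
open Summit.QuantumFields.YangMills.Theorems.Prop7LocalComparisonKnit (localComparison_of_cube)
open Summit.QuantumFields.YangMills.Theorems.Prop7LODCubeGaugeFamily (hVplaq_cubeGauge hVbond_cubeGauge normSq_Qk_one_conj_le_cubeGauge)

variable (F : T3Family) {n K : ℕ} (h : n ≤ K) (c₀ cB : ℝ) [Fact (0 < c₀)] [Fact (0 < cB)]

set_option maxHeartbeats 400000 in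
/-- ★★★ **THE PER-CUBE (L6) COMPARISON AT THE CUBE GAUGE `σ_c = axialT U₀ c`, GAUGE ROWS DISCHARGED.**  = ✓`localComparison_of_cube` with `σ := axialT U₀ c`,
`δ := 2·regThreshold F n K ε₀·(R₀ + 7ℓ)`, `cK := (1+θ⁻¹)·4·(3·10¹⁰L¹⁰ε₀² + 192(ℓδ)²)·cB∕(c₀ℓ^d)`, and `hVplaq`∕`hVbond`∕`hKrow` proved (✓p756563); `X` supported within `tdist ≤ R₀` of `c`, no wrap
`2(R₀ + 8ℓ + 1) ≤ sitesPerDir 0`, `10¹⁰L⁶ε₀ ≤ 1`, `10¹²L³ε₀ ≤ 1`.  Displayed: `hloc`, `hP1abs` (unchanged letters).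
[cite: Balaban1985BackgroundPropagators, (3.13)-(3.16) p.393, Thm 3.11 p.416; Balaban1985RegularSpaces, Lemma 1 (1.25) p.79; Balaban1985Averaging, pp.24-25] -/
theorem localComparison_of_cube_cubeGauge {ε₀ : ℝ} (hε₀ : 0 < ε₀) (hε : 10 ^ 10 * (F.L : ℝ) ^ 6 * ε₀ ≤ 1) (hε12 : 10 ^ 12 * (F.L : ℝ) ^ 3 * ε₀ ≤ 1)
    (c : Site (F.P K) 0)
    (U₀ : GaugeField (F.P K) 0 (Matrix.specialUnitaryGroup (Fin 2) ℂ)) (hreg : RegPr F n K ε₀ U₀)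
    (Q₀ : SiteL2K ℂ 3 (periodsT3 F K) c₀ W₂ →ₗ[ℂ] (Site (F.P K) (K - n) → Matrix (Fin 2) (Fin 2) ℂ))
    (hseq₀ : (∀ lam : Site (F.P K) 0 → Matrix (Fin 2) (Fin 2) ℂ, ∃ ns : (j : ℕ) → Site (F.P K) j → Matrix (Fin 2) (Fin 2) ℂ, ns 0 = lam ∧
      (∀ (j : ℕ) (y : Site (F.P K) (j + 1)), ns (j + 1) y = ns j (emb y) - meanCLM (Idx (F.P K)) (Matrix (Fin 2) (Fin 2) ℂ) fun i : Idx (F.P K) =>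
        ns j (emb y) - ((holT (emlIterU j (bgUnits F K U₀)) (emb y) (stairWord i.2.1 (off i.1)) : (Matrix (Fin 2) (Fin 2) ℂ)ˣ) : Matrix (Fin 2) (Fin 2) ℂ) *
          ns j (transl (emb y) (disp (stairWord i.2.1 (off i.1)))) * (((holT (emlIterU j (bgUnits F K U₀)) (emb y) (stairWord i.2.1 (off i.1)))⁻¹ : (Matrix (Fin 2) (Fin 2) ℂ)ˣ) : Matrix (Fin 2) (Fin 2) ℂ)) ∧
      ns (K - n) = Q₀ (toL2S F K c₀ lam)))
    (Q₁ : SiteL2K ℂ 3 (periodsT3 F K) c₀ W₂ →ₗ[ℂ] (Site (F.P K) (K - n) → Matrix (Fin 2) (Fin 2) ℂ))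
    (hseq₁ : (∀ lam : Site (F.P K) 0 → Matrix (Fin 2) (Fin 2) ℂ, ∃ ns : (j : ℕ) → Site (F.P K) j → Matrix (Fin 2) (Fin 2) ℂ, ns 0 = lam ∧
      (∀ (j : ℕ) (y : Site (F.P K) (j + 1)), ns (j + 1) y = ns j (emb y) - meanCLM (Idx (F.P K)) (Matrix (Fin 2) (Fin 2) ℂ) fun i : Idx (F.P K) =>
        ns j (emb y) - ((holT (emlIterU j (bgUnits F K (GaugeField.gaugeAct (axialT U₀ c) U₀))) (emb y) (stairWord i.2.1 (off i.1)) : (Matrix (Fin 2) (Fin 2) ℂ)ˣ) : Matrix (Fin 2) (Fin 2) ℂ) *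
          ns j (transl (emb y) (disp (stairWord i.2.1 (off i.1)))) * (((holT (emlIterU j (bgUnits F K (GaugeField.gaugeAct (axialT U₀ c) U₀))) (emb y) (stairWord i.2.1 (off i.1)))⁻¹ : (Matrix (Fin 2) (Fin 2) ℂ)ˣ) : Matrix (Fin 2) (Fin 2) ℂ)) ∧
      ns (K - n) = Q₁ (toL2S F K c₀ lam)))
    (Qf : SiteL2K ℂ 3 (periodsT3 F K) c₀ W₂ →ₗ[ℂ] (Site (F.P K) (K - n) → Matrix (Fin 2) (Fin 2) ℂ))
    (X : PBond (F.P K) 0 → Matrix (Fin 2) (Fin 2) ℂ) {R₀ : ℕ} (hX : ∀ b, X b ≠ 0 → Site.tdist c b.src ≤ R₀)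
    (hwrap : 2 * (R₀ + 8 * (F.P K).L ^ (K - n) + 1) ≤ (F.P K).sitesPerDir 0)
    {δP θ a c₆ : ℝ} (hδP : 0 ≤ δP) (hθ : 0 < θ) (hsmall : 3 * θ + δP ≤ 1) (ha : 0 ≤ a)
    (hloc : ‖⟪DstarL2 F n K c₀ (GaugeField.gaugeAct (axialT U₀ c) U₀) (toL2 F K c₀ (fun b => ((axialT U₀ c b.src : Matrix.specialUnitaryGroup (Fin 2) ℂ) : Matrix (Fin 2) (Fin 2) ℂ) * X b * star ((axialT U₀ c b.src : Matrix.specialUnitaryGroup (Fin 2) ℂ) : Matrix (Fin 2) (Fin 2) ℂ))),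
        (DstarL2 F n K c₀ (GaugeField.gaugeAct (axialT U₀ c) U₀) (toL2 F K c₀ (fun b => ((axialT U₀ c b.src : Matrix.specialUnitaryGroup (Fin 2) ℂ) : Matrix (Fin 2) (Fin 2) ℂ) * X b * star ((axialT U₀ c b.src : Matrix.specialUnitaryGroup (Fin 2) ℂ) : Matrix (Fin 2) (Fin 2) ℂ)))
          - projR (covLapSite F n K c₀ (GaugeField.gaugeAct (axialT U₀ c) U₀)) Q₁ (DstarL2 F n K c₀ (GaugeField.gaugeAct (axialT U₀ c) U₀) (toL2 F K c₀ (fun b => ((axialT U₀ c b.src : Matrix.specialUnitaryGroup (Fin 2) ℂ) : Matrix (Fin 2) (Fin 2) ℂ) * X b * star ((axialT U₀ c b.src : Matrix.specialUnitaryGroup (Fin 2) ℂ) : Matrix (Fin 2) (Fin 2) ℂ)))))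
        - (DstarL2 F n K c₀ (GaugeField.gaugeAct (axialT U₀ c) U₀) (toL2 F K c₀ (fun b => ((axialT U₀ c b.src : Matrix.specialUnitaryGroup (Fin 2) ℂ) : Matrix (Fin 2) (Fin 2) ℂ) * X b * star ((axialT U₀ c b.src : Matrix.specialUnitaryGroup (Fin 2) ℂ) : Matrix (Fin 2) (Fin 2) ℂ)))
          - projR (covLapSite F n K c₀ 1) Qf (DstarL2 F n K c₀ (GaugeField.gaugeAct (axialT U₀ c) U₀) (toL2 F K c₀ (fun b => ((axialT U₀ c b.src : Matrix.specialUnitaryGroup (Fin 2) ℂ) : Matrix (Fin 2) (Fin 2) ℂ) * X b * star ((axialT U₀ c b.src : Matrix.specialUnitaryGroup (Fin 2) ℂ) : Matrix (Fin 2) (Fin 2) ℂ)))))⟫_ℂ‖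
      ≤ δP * ‖DstarL2 F n K c₀ (GaugeField.gaugeAct (axialT U₀ c) U₀) (toL2 F K c₀ (fun b => ((axialT U₀ c b.src : Matrix.specialUnitaryGroup (Fin 2) ℂ) : Matrix (Fin 2) (Fin 2) ℂ) * X b * star ((axialT U₀ c b.src : Matrix.specialUnitaryGroup (Fin 2) ℂ) : Matrix (Fin 2) (Fin 2) ℂ)))‖ ^ 2)
    (hP1abs : ‖DstarL2 F n K c₀ 1 (toL2 F K c₀ (fun b => ((axialT U₀ c b.src : Matrix.specialUnitaryGroup (Fin 2) ℂ) : Matrix (Fin 2) (Fin 2) ℂ) * X b * star ((axialT U₀ c b.src : Matrix.specialUnitaryGroup (Fin 2) ℂ) : Matrix (Fin 2) (Fin 2) ℂ)))‖ ^ 2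
      ≤ ‖projR (covLapSite F n K c₀ 1) Qf (DstarL2 F n K c₀ 1 (toL2 F K c₀ (fun b => ((axialT U₀ c b.src : Matrix.specialUnitaryGroup (Fin 2) ℂ) : Matrix (Fin 2) (Fin 2) ℂ) * X b * star ((axialT U₀ c b.src : Matrix.specialUnitaryGroup (Fin 2) ℂ) : Matrix (Fin 2) (Fin 2) ℂ))))‖ ^ 2 + c₆ * ‖toL2 F K c₀ (fun b => ((axialT U₀ c b.src : Matrix.specialUnitaryGroup (Fin 2) ℂ) : Matrix (Fin 2) (Fin 2) ℂ) * X b * star ((axialT U₀ c b.src : Matrix.specialUnitaryGroup (Fin 2) ℂ) : Matrix (Fin 2) (Fin 2) ℂ))‖ ^ 2) :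
    (1 - (3 * θ + δP)) * (RCLike.re ⟪toL2 F K c₀ (fun b => ((axialT U₀ c b.src : Matrix.specialUnitaryGroup (Fin 2) ℂ) : Matrix (Fin 2) (Fin 2) ℂ) * X b * star ((axialT U₀ c b.src : Matrix.specialUnitaryGroup (Fin 2) ℂ) : Matrix (Fin 2) (Fin 2) ℂ)), DeltaEta F n K c₀ 1 (toL2 F K c₀ (fun b => ((axialT U₀ c b.src : Matrix.specialUnitaryGroup (Fin 2) ℂ) : Matrix (Fin 2) (Fin 2) ℂ) * X b * star ((axialT U₀ c b.src : Matrix.specialUnitaryGroup (Fin 2) ℂ) : Matrix (Fin 2) (Fin 2) ℂ)))⟫_ℂ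
          + ‖projR (covLapSite F n K c₀ 1) Qf (DstarL2 F n K c₀ 1 (toL2 F K c₀ (fun b => ((axialT U₀ c b.src : Matrix.specialUnitaryGroup (Fin 2) ℂ) : Matrix (Fin 2) (Fin 2) ℂ) * X b * star ((axialT U₀ c b.src : Matrix.specialUnitaryGroup (Fin 2) ℂ) : Matrix (Fin 2) (Fin 2) ℂ))))‖ ^ 2
          + a * ‖Qk F n K h c₀ cB (1 : GaugeField (F.P K) 0 (Matrix.specialUnitaryGroup (Fin 2) ℂ)) (toL2 F K c₀ (fun b => ((axialT U₀ c b.src : Matrix.specialUnitaryGroup (Fin 2) ℂ) : Matrix (Fin 2) (Fin 2) ℂ) * X b * star ((axialT U₀ c b.src : Matrix.specialUnitaryGroup (Fin 2) ℂ) : Matrix (Fin 2) (Fin 2) ℂ)))‖ ^ 2)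
        - (((1 + θ⁻¹) * (16 * ((eta F n K)⁻¹) ^ 2 * (2 * regThreshold F n K ε₀ * ((R₀ : ℝ) + 7 * (F.L : ℝ) ^ (K - n))) ^ 2) + (1 + θ) * (1029 * ε₀)) + (1 + θ⁻¹) * (12 * ((eta F n K)⁻¹) ^ 2 * (2 * regThreshold F n K ε₀ * ((R₀ : ℝ) + 7 * (F.L : ℝ) ^ (K - n))) ^ 2)
            + (1 + θ⁻¹) * (12 * ((eta F n K)⁻¹) ^ 2 * (2 * regThreshold F n K ε₀ * ((R₀ : ℝ) + 7 * (F.L : ℝ) ^ (K - n))) ^ 2) + a * ((1 + θ⁻¹) * (4 * (3 * 10 ^ 10 * (F.L : ℝ) ^ 10 * ε₀ ^ 2 + 192 * ((F.L : ℝ) ^ (K - n) * (2 * regThreshold F n K ε₀ * ((R₀ : ℝ) + 7 * (F.L : ℝ) ^ (K - n)))) ^ 2) * (cB / (c₀ * ((F.L : ℝ) ^ (K - n)) ^ (F.P K).d)))) + (2 * θ + δP) * c₆) * ‖toL2 F K c₀ X‖ ^ 2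
      ≤ RCLike.re ⟪toL2 F K c₀ X, DeltaEta F n K c₀ U₀ (toL2 F K c₀ X)⟫_ℂ
          + ‖projR (covLapSite F n K c₀ U₀) Q₀ (DstarL2 F n K c₀ U₀ (toL2 F K c₀ X))‖ ^ 2
          + a * ‖Qk F n K h c₀ cB U₀ (toL2 F K c₀ X)‖ ^ 2 := by
  have ha₀ := regThreshold_pos F (n := n) (K := K) hε₀
  have hL0 : (0 : ℝ) ≤ (F.L : ℝ) ^ (K - n) := by positivity
  have hc₀ : (0 : ℝ) < c₀ := Fact.out
  have hcB : (0 : ℝ) < cB := Fact.out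
  have hδ : 0 ≤ (2 * regThreshold F n K ε₀ * ((R₀ : ℝ) + 7 * (F.L : ℝ) ^ (K - n))) := by positivity
  have hcK : 0 ≤ ((1 + θ⁻¹) * (4 * (3 * 10 ^ 10 * (F.L : ℝ) ^ 10 * ε₀ ^ 2 + 192 * ((F.L : ℝ) ^ (K - n) * (2 * regThreshold F n K ε₀ * ((R₀ : ℝ) + 7 * (F.L : ℝ) ^ (K - n)))) ^ 2) * (cB / (c₀ * ((F.L : ℝ) ^ (K - n)) ^ (F.P K).d)))) := by positivity
  exact localComparison_of_cube F h c₀ cB hε₀.le (axialT U₀ c) U₀ hreg Q₀ hseq₀ Q₁ hseq₁ Qf X hδ hδP hθ hsmall ha hcK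
    (hVplaq_cubeGauge F n K hε₀ U₀ hreg c X hX hwrap) (hVbond_cubeGauge F n K hε₀ U₀ hreg c X hX hwrap) hloc
    (normSq_Qk_one_conj_le_cubeGauge F n K h c₀ cB hε₀ hε hε12 U₀ hreg c X hX hwrap hθ) hP1abs

end Summit.QuantumFields.YangMills.Theorems.Prop7LocalComparisonCubeGauge

end
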